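import Literature.NumberTheory.LFunctions.YoshidaWindowGramColumnData
import HarnessLib

/-!
# C∞ rung `R1E` (even sector) — DATA `CON` part 1/1

Route context: Fourier–Galerkin / Schur-complement certificates of Weil positivity on a window ("format C", C∞ door `weilPositivityOn_of_cinf_pipeline`); supporting stmt-RiemannHypothesis-0098; seat rh-explicit-weil-2 (`cinfemit.py`/`emit_lean2.py`, HOME/rh-explicit-weil-2/gen17/EMITTER-PHASE2.md). Data / bookkeeping only; standard axioms; no RH claim.
-/

set_option autoImplicit false
-- `Summit.RiemannHypothesis.RiemannHypothesis.…` is the layout-mandated namespace (summit = problem name).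
set_option linter.dupNamespace false

namespace Summit.RiemannHypothesis.RiemannHypothesis.Theorems.WeilFormatC

open Literature.NumberTheory.LFunctions

namespace CinfR1E

/-- Packed rows part 1/1 of table `CON` (word width 129, 6 words). -/
def CON_P : List ℕ := [
  0x200000000000000000000000000000001000000000000000000000000000000008000000000000000000000000000000040000000000ab3f601000000000000001ffffffffff54c09ff00000000000000100000000002acfd80400000000000000,
  0x20000000000000000000000000000000100000000000000000000000000000000800000015edd8dcc32000000000000003ffffffc930524fe5dc00000000000002000000265d4b0a87cc00000000000000fffffff7c78acb2a3f00000000000000,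
  0x200000000000000000000000000000001000013d7167db86fe0000000000000007fffa3726b8765aecd800000000000004000a1f124f1514ff6c00000000000001fff998d7f2a4634ff20000000000000100015113855c054ab100000000000000,
  0x200a813daae33a1969200000000000000fb1413740cfba2c578000000000000009012d4e00c2707e3cd0000000000000026945d45a7ec4e6dd8800000000000002f9ef323f20877c584200000000000000cd292aa853a784c42200000000000000]

end CinfR1E

end Summit.RiemannHypothesis.RiemannHypothesis.Theorems.WeilFormatC
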